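import Mathlib
import HarnessLib
import HarnessLib.Audit
import Summits.Langlands.Statement
import Summits.Langlands.Langlands.Theses.RootDecomp1
import Literature.NumberTheory.GaloisRepresentations.HeckeDeterminant
import Summits.Langlands.Langlands.Theses.DeterminantTowerSplit

/-! BC3 birth skeleton for crux `IntegralFrobeniusData` (INT) of the child route DeterminantTowerSplit (lens-3 g16; refines RootDecomp1:AccessibleAvatars 29148).
POST-BIRTH form: concludes the ROUTE decl by name.
Stubs: stub_intRegular, stub_intIrregular — each a genuine theorem-sized piece (population split along the catalogued barriers), none restates the crux or the summit (probes: probes/). `IntegralFrobeniusData_of` is proved (case split); sorries ONLY inside `stub_*`. -/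

set_option linter.unusedVariables false
set_option linter.dupNamespace false

namespace Summit.Langlands.Langlands.Cruxes.IntegralFrobeniusData.Birth

open scoped BigOperators Topology Manifold Classical MeasureTheory ProbabilityTheory Matrix InnerProductSpace ComplexConjugate ContinuousMap
open Filter Set Function TopologicalSpace MeasureTheory

open Summit.Langlands.Langlands.Theses.DeterminantTowerSplit (IntegralFrobeniusData)

/-- INT on the REGULAR population = FIRST RUNG (BC5, plan-only): for π with a regular infinity type, the ℓ-adic field of rationality and ℓ-integrality of the Satake polynomials. PRINT modulo typing for EVERY number field K (no Shimura variety needed): Clozel 1990 Thm 3.13 (π_f defined over a number field E(π), via (𝔤,K)-cohomology of X_K with algebraic coefficients, Franke), integral structure of Betti cohomology ⇒ normalised Hecke eigenvalues are algebraic integers, q_v ∈ 𝒪^× for v ∤ ℓ; even n: the L-normalisation adds √q_v ∈ the compositum of the finitely many quadratic extensions of ℚ_ℓ. OUTSIDE Acc's known regime when [K:K⁺] = 2 and K is not CM (ShimuraVarietyRealizationBarrier). Technique: typing Clozel rationality as a Literature fact `isRational_finitePart_of_isRegularAlgebraic` + an integrality fact, then bookkeeping with `arithFrobPolyOfSatake`.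 -/
theorem stub_intRegular :
    ∀ (K : Type) [Field K] [NumberField K] (n : ℕ) (hcpt : Literature.NumberTheory.Automorphic.isCompact_glFiniteIntegralLevel n K), 0 < n → Module.finrank (NumberField.maximalRealSubfield K) K ≤ 2 → ∀ (π : Literature.NumberTheory.Automorphic.CuspidalAutomorphicRepData n K hcpt), π.1.IsLAlgebraic → (∃ T : Literature.NumberTheory.Automorphic.InfinityType K n, π.1.HasInfinityType T ∧ T.IsRegular) → ∀ (ℓ : ℕ) [Fact ℓ.Prime] (ι : PadicAlgCl ℓ ≃+* ℂ), ∃ E : IntermediateField ℚ_[ℓ] (PadicAlgCl ℓ), FiniteDimensional ℚ_[ℓ] E ∧ ∀ᶠ v : IsDedekindDomain.HeightOneSpectrum (NumberField.RingOfIntegers K) in Filter.cofinite, ∃ α : Multiset ℂ, π.1.HasSatakeParamAt v α ∧ ∀ i : ℕ, (Literature.NumberTheory.Automorphic.arithFrobPolyOfSatake ι v.residueCard 1 α).coeff i ∈ E ∧ (Literature.NumberTheory.Automorphic.arithFrobPolyOfSatake ι v.residueCard 1 α).coeff i ∈ (Valued.v : Valuation (PadicAlgCl ℓ) NNReal).valuationSubring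 := by
  sorry

/-- INT on the IRREGULAR population (OPEN; inside NonRegularWeightBarrier): for π L-algebraic with no regular infinity type (Maass λ = 1/4, non-degenerate limits of discrete series …) the same rationality + integrality. Scholze 2015 §1: «it is not even known that the eigenvalues of the Hecke operators are algebraic». The weakest named consequence of Acc on this population; candidate inputs: trace-formula transfer to a cohomological form on an inner form / functorial image with known rationality field, Jacquet–Langlands, converse theorems. -/
theorem stub_intIrregular :
    ∀ (K : Type) [Field K] [NumberField K] (n : ℕ) (hcpt : Literature.NumberTheory.Automorphic.isCompact_glFiniteIntegralLevel n K), 0 < n → Module.finrank (NumberField.maximalRealSubfield K) K ≤ 2 → ∀ (π : Literature.NumberTheory.Automorphic.CuspidalAutomorphicRepData n K hcpt), π.1.IsLAlgebraic → ¬ (∃ T : Literature.NumberTheory.Automorphic.InfinityType K n, π.1.HasInfinityType T ∧ T.IsRegular) → ∀ (ℓ : ℕ) [Fact ℓ.Prime] (ι : PadicAlgCl ℓ ≃+* ℂ), ∃ E : IntermediateField ℚ_[ℓ] (PadicAlgCl ℓ), FiniteDimensional ℚ_[ℓ] E ∧ ∀ᶠ v : IsDedekindDomain.HeightOneSpectrum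 (NumberField.RingOfIntegers K) in Filter.cofinite, ∃ α : Multiset ℂ, π.1.HasSatakeParamAt v α ∧ ∀ i : ℕ, (Literature.NumberTheory.Automorphic.arithFrobPolyOfSatake ι v.residueCard 1 α).coeff i ∈ E ∧ (Literature.NumberTheory.Automorphic.arithFrobPolyOfSatake ι v.residueCard 1 α).coeff i ∈ (Valued.v : Valuation (PadicAlgCl ℓ) NNReal).valuationSubring := by
  sorry

/-- the composition: the stubs imply the crux (population case split). -/
theorem IntegralFrobeniusData_of :
    (∀ (K : Type) [Field K] [NumberField K] (n : ℕ) (hcpt : Literature.NumberTheory.Automorphic.isCompact_glFiniteIntegralLevel n K), 0 < n → Module.finrank (NumberField.maximalRealSubfield K) K ≤ 2 → ∀ (π : Literature.NumberTheory.Automorphic.CuspidalAutomorphicRepData n K hcpt), π.1.IsLAlgebraic → (∃ T : Literature.NumberTheory.Automorphic.InfinityType K n, π.1.HasInfinityType T ∧ T.IsRegular) → ∀ (ℓ : ℕ) [Fact ℓ.Prime] (ι : PadicAlgCl ℓ ≃+* ℂ), ∃ E : IntermediateField ℚ_[ℓ] (PadicAlgCl ℓ), FiniteDimensional ℚ_[ℓ]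 E ∧ ∀ᶠ v : IsDedekindDomain.HeightOneSpectrum (NumberField.RingOfIntegers K) in Filter.cofinite, ∃ α : Multiset ℂ, π.1.HasSatakeParamAt v α ∧ ∀ i : ℕ, (Literature.NumberTheory.Automorphic.arithFrobPolyOfSatake ι v.residueCard 1 α).coeff i ∈ E ∧ (Literature.NumberTheory.Automorphic.arithFrobPolyOfSatake ι v.residueCard 1 α).coeff i ∈ (Valued.v : Valuation (PadicAlgCl ℓ) NNReal).valuationSubring) →
    (∀ (K : Type) [Field K] [NumberField K] (n : ℕ) (hcpt : Literature.NumberTheory.Automorphic.isCompact_glFiniteIntegralLevel n K), 0 < n → Module.finrank (NumberField.maximalRealSubfield K) K ≤ 2 → ∀ (π : Literature.NumberTheory.Automorphic.CuspidalAutomorphicRepData n K hcpt), π.1.IsLAlgebraic → ¬ (∃ T : Literature.NumberTheory.Automorphic.InfinityType K n, π.1.HasInfinityType T ∧ T.IsRegular) → ∀ (ℓ : ℕ) [Fact ℓ.Prime] (ι : PadicAlgCl ℓ ≃+* ℂ), ∃ E : IntermediateField ℚ_[ℓ] (PadicAlgCl ℓ), FiniteDimensional ℚ_[ℓ] E ∧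 ∀ᶠ v : IsDedekindDomain.HeightOneSpectrum (NumberField.RingOfIntegers K) in Filter.cofinite, ∃ α : Multiset ℂ, π.1.HasSatakeParamAt v α ∧ ∀ i : ℕ, (Literature.NumberTheory.Automorphic.arithFrobPolyOfSatake ι v.residueCard 1 α).coeff i ∈ E ∧ (Literature.NumberTheory.Automorphic.arithFrobPolyOfSatake ι v.residueCard 1 α).coeff i ∈ (Valued.v : Valuation (PadicAlgCl ℓ) NNReal).valuationSubring) →
    IntegralFrobeniusData := by
  intro h1 h2 K _ _ n hcpt hn hK π hπ
  by_cases hreg : (∃ T : Literature.NumberTheory.Automorphic.InfinityType K n, π.1.HasInfinityType T ∧ T.IsRegular)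
  · exact h1 K n hcpt hn hK π hπ hreg
  · exact h2 K n hcpt hn hK π hπ hreg

theorem IntegralFrobeniusData_holds : IntegralFrobeniusData := IntegralFrobeniusData_of stub_intRegular stub_intIrregular

theorem IntegralFrobeniusData_proof : Summit.Langlands.Langlands.Theses.DeterminantTowerSplit.IntegralFrobeniusData := IntegralFrobeniusData_holds

end Summit.Langlands.Langlands.Cruxes.IntegralFrobeniusData.Birth
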